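import Literature.AlgebraicGeometry.Resolution.RegularLocalRingsQuotient
import Literature.AlgebraicGeometry.Resolution.RegularSystemOfParameters
import HarnessLib

/-!
# Stub `stub_extendParameter` for crux stmt-ResolutionOfSingularities-15917
(`RadicialJung.CleanModels`, line `Sketch`)

**A regular parameter extends to a regular system of parameters.** Let `O` be a regular local
ring and `t₀ ∈ 𝔪 ∖ 𝔪²`. Then there are `d = dim O ≥ 1` elements `t : Fin d → O` generating `𝔪`
with `t 0 = t₀`.

Proof. `O₁ = O/(t₀)` is a regular local ring with `dim O₁ + 1 = dim O` (Matsumura Thm. 14.2, the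
tree's `IsRegularLocalRing.quotient_span_singleton`). Lift a regular system of parameters
`u : Fin e → O₁` (`e = dim O₁`, the tree's `exists_regularSystemOfParameters`) to `v : Fin e → O`
and put `t = (t₀, v)`: since `O → O₁` is a local surjection with kernel `(t₀)`, the preimage `𝔪`
of `𝔪_{O₁} = (u)` is `(v) + (t₀) = (t)`.
-/

set_option linter.dupNamespace false

open IsLocalRing
open Literature.AlgebraicGeometry.Resolution

namespace Summit.ResolutionOfSingularities.ResolutionOfSingularities.Theorems.RadicialJung.CleanModels

/-- **A regular parameter extends to a regular system of parameters.** If `O` is a regular local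
ring and `t₀ ∈ 𝔪 ∖ 𝔪²`, then there are `d = dim O` elements `t : Fin d → O` (`d ≥ 1`) generating
the maximal ideal with `t 0 = t₀` (`O/(t₀)` is regular of dimension `d - 1`, Matsumura Thm. 14.2:
lift a regular system of parameters of it and prepend `t₀`). -/
theorem stub_extendParameter {O : Type*} [CommRing O] [IsRegularLocalRing O] (t₀ : O)
    (h₁ : t₀ ∈ maximalIdeal O) (h₂ : t₀ ∉ maximalIdeal O ^ 2) :
    ∃ (d : ℕ) (hd0 : 0 < d) (t : Fin d → O), Ideal.span (Set.range t) = maximalIdeal O ∧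
      ringKrullDim O = (d : WithBot ℕ∞) ∧ t ⟨0, hd0⟩ = t₀ := by
  -- `O₁ = O/(t₀)` is regular local with `dim O₁ + 1 = dim O`
  obtain ⟨hreg, hdim⟩ := IsRegularLocalRing.quotient_span_singleton h₁ h₂
  -- a regular system of parameters `u` of `O₁` (`e = dim O₁` generators of its maximal ideal)
  obtain ⟨e, u, hu, hdime⟩ : ∃ (e : ℕ) (u : Fin e → O ⧸ Ideal.span {t₀}),
      Ideal.span (Set.range u) = maximalIdeal (O ⧸ Ideal.span {t₀}) ∧
      ringKrullDim (O ⧸ Ideal.span {t₀}) = (e : WithBot ℕ∞) := by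
    obtain ⟨u, hu⟩ := exists_regularSystemOfParameters (R := O ⧸ Ideal.span {t₀})
    exact ⟨_, u, hu, (IsRegularLocalRing.spanFinrank_maximalIdeal).symm⟩
  -- lift it to `O` and prepend `t₀`
  choose v hv using fun k => Ideal.Quotient.mk_surjective (u k)
  have huv : (Ideal.Quotient.mk (Ideal.span {t₀})) ∘ v = u := funext hv
  refine ⟨e + 1, Nat.succ_pos e, Fin.cons t₀ v, ?_, ?_, rfl⟩
  · -- `(t₀, v) = 𝔪`: the preimage of `𝔪_{O₁} = (u)` under the local surjection `O → O₁`
    have hmap : (Ideal.span (Set.range v)).map (Ideal.Quotient.mk (Ideal.span {t₀})) =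
        maximalIdeal (O ⧸ Ideal.span {t₀}) := by
      rw [Ideal.map_span, ← Set.range_comp, huv, hu]
    haveI : IsLocalHom (Ideal.Quotient.mk (Ideal.span {t₀})) :=
      IsLocalHom.of_surjective _ Ideal.Quotient.mk_surjective
    rw [Fin.range_cons, Ideal.span_insert,
      ← IsLocalRing.maximalIdeal_comap (Ideal.Quotient.mk (Ideal.span {t₀})), ← hmap,
      Ideal.comap_map_of_surjective' _ Ideal.Quotient.mk_surjective, Ideal.mk_ker, sup_comm]
  · -- `dim O = dim O₁ + 1 = e + 1`
    rw [← hdim, hdime, Nat.cast_succ]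

end Summit.ResolutionOfSingularities.ResolutionOfSingularities.Theorems.RadicialJung.CleanModels
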